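import Summits.CriticalPhenomena.PercolationContinuityZ3.Theorems.PercNearOneGluingNoHeavyQuantHubBlocksProfileConjecture
import Summits.CriticalPhenomena.PercolationContinuityZ3.Theorems.PercNearOneGluingNoHeavyQuantMonoHubPairing
import HarnessLib

/-!
# QUANT lane R8, FAR on trees: the profile conjecture for MONOTONE hub laws (typed), and the symmetric conjecture
# 'GATED MONOTONE SUMMANDS' (typed)

builds on p205010 (kernel theorem, internal audit signed; external expert review pending)

Statement + support file (`--supports stmt-CriticalPhenomena-4575`), QUANT lane typer seat prim-quant-stmt (gen 13); memo
`run/shared/lean/prim/quant/prim-quant-stmt-g13/MONO-RELAXATION.md` §1–§3.  Two `Prop` definitions (OPEN inequality families, `@[conjecture]`),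
theorems otherwise; no sorries; standard axioms.

* `Quant.HubBlocksProfileIneqMono` — the profile conjecture `Quant.HubBlocksProfileIneq` (gen 12) with the hub hypothesis WEAKENED from
  'ratio-regular below the mean' (`μ·p(b−1) ≤ b·p b`, `b ≤ μ`) to 'pmf nondecreasing below the mean' (`p(b−1) ≤ p b`, `b ≤ μ`).  Status OPEN;
  exact census 340 000 / 0 (memo §1); PROVED for `K = ∅` and `K = {x}` (`Quant.hubBlocksProfileIneq_mono_empty/_singleton`,
  `…QuantMonoHubOneBlock.lean`) and reduced to the uniform-window vertex inequalities `(V^u_{t,b₁})` (`Quant.mono_expectation_ge_of_vertices`,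
  `…QuantMonotoneCertificate.lean`).
* `Quant.hubBlocksProfileIneq_of_mono` — `HubBlocksProfileIneqMono → HubBlocksProfileIneq` (ratio-regular ⟹ monotone, `Quant.mono_of_ratioRegular`).
* `Quant.GatedMonotoneSumIneq` — **conjecture (H), 'gated monotone summands'**: for independent `H_i = η_i·Y_i` (`η_i ~ Ber(G_i)`, `Y_i` a law on
  `{0,…,m_i}` with mean `μ_i > 0` and pmf nondecreasing on `[0, μ_i]`), `Σ_i G_i μ_i > 2j ⟹ P(Σ_i H_i ≥ j+1) ≥ min_i G_i μ_i/m_i`.  A blob `(a, g)`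
  is such an object (`Y ≡ a`, `G = g`), a hub with Poisson-binomial leaves behind a gate is another (`Quant.pb_pmf_mono`); so (H) contains the blob
  row `Quant.halfMean_smallBall`, `HubBlocksProfileIneqMono`, and the two-hub family of MTL-PROFILE-LP §9.  Stated with the law of `Σ_i H_i` written
  out as a finite sum over gate patterns `S ⊆ Fin r` and value vectors `y ∈ Π_i {0,…,m_i}` (no measure theory).  Status OPEN; exact census over
  vertex tuples `r = 2,3,4`: 20 500 / 0 (memo §3).
* `Quant.gatedMonotoneSumIneq_one` — sanity/consistency: (H) for ONE object is the average-gate star row for monotone laws, PROVED here from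
  `Quant.mono_profile_oneLightBlock` (so the `r = 1` slice of the typed statement is inhabited exactly as intended).
[cite: KozmaNitzan2024, Conjecture 3 (p. 15)] (the gluing rows served); the statements are [this work].
-/

noncomputable section

namespace Summit.CriticalPhenomena.PercolationContinuityZ3.Theorems

namespace Quant

open Finset MeasureTheory
open Literature.Probability.LatticeModels
open Literature.Probability.Percolation
open scoped Classical

/-- **The profile conjecture for monotone hub laws.**  As `Quant.HubBlocksProfileIneq`, but the hub law `p` on `{0,…,m}` (mean `μ > 0`) is only
assumed to have a pmf NONDECREASING below the mean: `p(b−1) ≤ p b` for `1 ≤ b ≤ μ`.  Claim: if `2j < Σ_{x∈K} size x·q x + G·μ` then every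
`τ ≤ μ/m` with `G·τ ≤ q x` (`x ∈ K`) satisfies `τ ≤ Σ_{b ≤ m} p b·(P(W ≥ j+1−b) + ((1−G)/G)·P(W ≥ j+1))`, `W(ω) = Σ_{x ∈ K ∩ ω} size x`.
OPEN (census 340 000 / 0; memo MONO-RELAXATION.md §1); proved for `|K| ≤ 1`. [status: open] [this work] -/
@[conjecture] def HubBlocksProfileIneqMono : Prop :=
  ∀ (n : ℕ) (q : Fin n → unitInterval) (K : Finset (Fin n)) (size : Fin n → ℕ) (m : ℕ) (p : ℕ → ℝ) (μ G τ : ℝ) (j : ℕ),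
    (∀ b, 0 ≤ p b) →
    (∑ b ∈ Finset.range (m + 1), p b = 1) →
    (∑ b ∈ Finset.range (m + 1), (b : ℝ) * p b = μ) →
    0 < μ →
    (∀ b : ℕ, 1 ≤ b → (b : ℝ) ≤ μ → p (b - 1) ≤ p b) →
    0 < G → G ≤ 1 →
    (2 * j : ℝ) < (∑ x ∈ K, (size x : ℝ) * (q x : ℝ)) + G * μ →
    τ ≤ μ / m →
    (∀ x ∈ K, G * τ ≤ (q x : ℝ)) →
    τ ≤ ∑ b ∈ Finset.range (m + 1), p b *
      ((prodBernoulli q).real {ω : Set (Fin n) | j + 1 - b ≤ ∑ x ∈ K.filter (fun x => x ∈ ω), size x} +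
        (1 - G) / G * (prodBernoulli q).real {ω : Set (Fin n) | j + 1 ≤ ∑ x ∈ K.filter (fun x => x ∈ ω), size x})

/-- **Monotone form implies the ratio-regular form**: `HubBlocksProfileIneqMono → HubBlocksProfileIneq` (a ratio-regular law is monotone below
its mean, `Quant.mono_of_ratioRegular`). [this work] -/
theorem hubBlocksProfileIneq_of_mono (h : HubBlocksProfileIneqMono) : HubBlocksProfileIneq := by
  intro n q K size m p μ G τ j hp0 hsum hmean hμ hratio hG0 hG1 hEN hτ hτK
  exact h n q K size m p μ G τ j hp0 hsum hmean hμ (mono_of_ratioRegular p μ hμ hp0 hratio) hG0 hG1 hEN hτ hτK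

/-- **Conjecture (H): gated monotone summands.**  Data: `r` objects; gates `G i ∈ (0,1]`; laws `p i` on `{0,…,m i}` (`p i b ≥ 0`, `Σ_b p i b = 1`)
with means `μ i > 0` and pmf nondecreasing on `[0, μ i]`.  The law of `N = Σ_i η_i Y_i` (`η_i ~ Ber(G i)`, `Y_i ~ p i`, all independent) is written
out: `P(N ≥ j+1) = Σ_{S ⊆ Fin r} Σ_{y ∈ Π_i {0..m i}} 1[j+1 ≤ Σ_{i∈S} y i]·Π_i (G i if i ∈ S else 1 − G i)·p i (y i)`.  Claim: if
`2j < Σ_i G i·μ i` then every `θ` with `θ ≤ G i·μ i/m i` for all `i` satisfies `θ ≤ P(N ≥ j+1)`.  Blobs (`p i = δ_{m i}`) and gated Poisson-binomial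
clusters are instances.  OPEN (census over vertex tuples, `r ≤ 4`: 20 500 / 0; memo MONO-RELAXATION.md §3). [status: open] [this work] -/
@[conjecture] def GatedMonotoneSumIneq : Prop :=
  ∀ (r : ℕ) (G μ : Fin r → ℝ) (m : Fin r → ℕ) (p : Fin r → ℕ → ℝ) (j : ℕ) (θ : ℝ),
    (∀ i b, 0 ≤ p i b) →
    (∀ i, ∑ b ∈ Finset.range (m i + 1), p i b = 1) →
    (∀ i, ∑ b ∈ Finset.range (m i + 1), (b : ℝ) * p i b = μ i) →
    (∀ i, 0 < μ i) →
    (∀ i (b : ℕ), 1 ≤ b → (b : ℝ) ≤ μ i → p i (b - 1) ≤ p i b) →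
    (∀ i, 0 < G i ∧ G i ≤ 1) →
    (2 * j : ℝ) < ∑ i, G i * μ i →
    (∀ i, θ ≤ G i * μ i / m i) →
    θ ≤ ∑ S : Finset (Fin r), ∑ y ∈ Fintype.piFinset (fun i => Finset.range (m i + 1)),
      (if j + 1 ≤ ∑ i ∈ S, y i then (∏ i, (if i ∈ S then G i else 1 - G i) * p i (y i)) else 0)

/-- **(H) for one object is the average-gate star row for monotone laws** (sanity slice of `Quant.GatedMonotoneSumIneq`, `r = 1`): for a law `p`
on `{0,…,m}` with mean `μ > 0`, pmf nondecreasing on `[0, μ]`, a gate `0 < G ≤ 1` with `2j < G·μ`, and `θ ≤ G·μ/m`: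
`θ ≤ G·Σ_{j < b ≤ m} p b` (`= P(η·Y ≥ j+1)`).  From `Quant.mono_profile_oneLightBlock` (`a = 0`). [this work] -/
theorem gatedMonotoneSum_one (m : ℕ) (p : ℕ → ℝ) (μ G θ : ℝ) (j : ℕ)
    (hp0 : ∀ b, 0 ≤ p b) (hsum : ∑ b ∈ Finset.range (m + 1), p b = 1)
    (hmean : ∑ b ∈ Finset.range (m + 1), (b : ℝ) * p b = μ) (hμ : 0 < μ)
    (hmono : ∀ b : ℕ, 1 ≤ b → (b : ℝ) ≤ μ → p (b - 1) ≤ p b)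
    (hG0 : 0 < G) (hG1 : G ≤ 1) (hEN : (2 * j : ℝ) < G * μ) (hθ : θ ≤ G * μ / m) :
    θ ≤ G * ∑ b ∈ Finset.range (m + 1), p b * (if j < b then (1 : ℝ) else 0) := by
  have hμm : μ ≤ m := mean_le_top p m μ hp0 hsum hmean
  have hm0 : 0 < m := by
    by_contra h; push Not at h; interval_cases m; simp at hμm; linarith
  have hm0' : (0 : ℝ) < m := by exact_mod_cast hm0
  have h2j : (2 * j : ℝ) < μ := by nlinarith
  have hmono' : ∀ b b' : ℕ, 1 ≤ b → b ≤ b' → b' ≤ 2 * j - 0 → p b ≤ p b' := by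
    intro b b' hb hbb' hb'
    have hb'' : b' ≤ 2 * j := by omega
    refine mono_chain p μ hmono hbb' ?_
    have : (b' : ℝ) ≤ 2 * j := by exact_mod_cast hb''
    linarith
  have hm' : 2 * j - 0 + 1 ≤ m := by
    have h1 : (2 * j : ℝ) < m := h2j.trans_le hμm
    have h2 : 2 * j < m := by exact_mod_cast h1
    omega
  have hMg : (j : ℝ) ≤ (m : ℝ) * 1 := by
    have : (j : ℝ) ≤ 2 * j := by linarith [(Nat.cast_nonneg j : (0 : ℝ) ≤ j)]
    linarith
  have key := mono_profile_oneLightBlock p m j 0 m 1 (Nat.zero_le _) hp0 hmono' hm' le_rfl hMg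
  rw [hmean] at key
  have e : ∑ b ∈ Finset.range (m + 1), p b * ((if j < b then (1 : ℝ) else 0) + 1 * (if j - 0 < b ∧ b ≤ j then (1 : ℝ) else 0)) =
      ∑ b ∈ Finset.range (m + 1), p b * (if j < b then (1 : ℝ) else 0) := by
    refine Finset.sum_congr rfl fun b _ => ?_
    have c2 : ¬ (j - 0 < b ∧ b ≤ j) := by omega
    rw [if_neg c2]; ring
  rw [e] at key
  -- `μ ≤ m·S` and `θ ≤ Gμ/m` give `θ ≤ G·S`
  set S := ∑ b ∈ Finset.range (m + 1), p b * (if j < b then (1 : ℝ) else 0) with hS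
  have hS0 : 0 ≤ S := Finset.sum_nonneg fun b _ => mul_nonneg (hp0 b) (by split_ifs <;> norm_num)
  have h1 : μ / m ≤ S := by rw [div_le_iff₀ hm0']; linarith
  calc θ ≤ G * μ / m := hθ
    _ = G * (μ / m) := by ring
    _ ≤ G * S := mul_le_mul_of_nonneg_left h1 hG0.le

end Quant

end Summit.CriticalPhenomena.PercolationContinuityZ3.Theorems
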